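import Mathlib
import Summits.Schanuel.Schanuel.Theorems.RootDecomp1EEngineTypeCells

-- `Summit.Schanuel.Schanuel.…` is the mandated layout of this single-problem summit (CONVENTIONS §1).
set_option linter.dupNamespace false

/-!
# RootDecomp1E — lens 2, gen 10 «EngineType» (part 3/3): the `√3`-cell `z₃ = (1, π√3, iπ√3)` of clause (N′)

THEOREM ROUND on `route-Schanuel-RootDecomp1E`, supporting the residual `RootDecomp1E.PlainDefectOne`
(stmt-Schanuel-31410) at its first open length `n = 3`.  A THIRD certified member of 31410's hypothesis class — ℚ-free,
PLAIN (no irrational ALGEBRAIC multiplier; here the transcendence of `π`, tree theorem `transcendental_pi_holds`, is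
used), sub-minimal — on which 31410's conclusion `3 ≤ trdeg F_z + 1` is PROVED mod the tree fact `nesterenko'`
(Nesterenko's `π ⊥ e^{π√3}`; PROVED in the tree as `nesterenko'_holds`, hypothesis form only because its cone has no
farm olean): `trdeg ℚ(π√3, e, e^{π√3}, e^{iπ√3}) ≥ 2` since `π = π√3 · (√3)⁻¹ ∈ F^{alg}` and `e^{π√3} ∈ F`.  None of the
clauses (M), (L), (N) of part 1 certifiably decides `z₃` (one algebraic point in the span; `π ∉ span_ℚ z₃`), so this is
the cell by which clause (N′) earns its place (critic verdict 2026-08-30T12:22:22Z (3)).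
Sorry-free; axioms `propext`, `Classical.choice`, `Quot.sound`.
[cite: NesterenkoPhilippon2001, Ch. 3 Cor. 1.2] [cite: Nesterenko1996SbMath] [cite: BakerTNT1975, Ch. 1 Thm 1.3]
-/

noncomputable section

namespace Summit.Schanuel.Schanuel.Theorems.RootDecomp1EEngineType

open Complex IntermediateField
open Summit.Schanuel.Schanuel.Theorems.RootDecomp1EAnchor (isAlgebraic_of_mem_adjoin mem_adjoin_of_mem_span
  exp_isAlgebraic_of_mem_span)
open Summit.Schanuel.Schanuel.Theorems.RootDecomp1EModuleGrids (subMinimal_three)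
open Summit.Schanuel.Schanuel.Theorems.RootDecomp1EModuleType (SubMinimalDefect)
open Literature.Barriers.Schanuel (isAlgebraic_I)
open Literature.NumberTheory.Transcendental (nesterenko' transcendental_pi_holds)

/-! ## §7 The `√3`-cell of clause (N′): `z₃ = (1, π√3, iπ√3)` (`e`, `e^{π√3}`, `e^{iπ√3}`)

`z₃` is a member of stmt-31410's hypothesis class at `n = 3` (ℚ-free · NO irrational algebraic multiplier · sub-minimal)
that NONE of (M), (L), (N) certifiably removes (one algebraic point in the span → Lindemann–Weierstrass gives `trdeg ≥ 1`
only; `π ∉ span_ℚ z₃`; a grid of logarithms algebraic over `F_{z₃}` is transcendence-open), and clause (N′) DOES: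
`π√3 ∈ F`, so `π = π√3/√3 ∈ F^{alg}` and `e^{π√3} ∈ F`, whence `trdeg F ≥ 2` by Nesterenko's `π ⊥ e^{π√3}` — the
conclusion of 31410 at `z₃`, PROVED mod `nesterenko'` only.  Transcendence of `π` (Lindemann, tree theorem
`transcendental_pi_holds`) is what makes `z₃` ℚ-free and plain. -/

/-- `π ∈ ℂ` is transcendental (tree theorem `transcendental_pi_holds`, transported along `ℝ → ℂ`). -/
private theorem transcendental_pi_coe : Transcendental ℚ (Real.pi : ℂ) := fun h =>
  transcendental_pi_holds ((isAlgebraic_algebraMap_iff (A := ℂ) Complex.ofReal_injective).mp h)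

/-- `√3 ∈ ℂ` is algebraic (`X² − 3`). -/
theorem isAlgebraic_sqrt_three : IsAlgebraic ℚ (Real.sqrt 3 : ℂ) := by
  refine ⟨Polynomial.X ^ 2 - Polynomial.C 3, Polynomial.X_pow_sub_C_ne_zero (by norm_num) 3, ?_⟩
  have h3 : ((Real.sqrt 3 : ℝ) : ℂ) ^ 2 = 3 := by
    rw [← Complex.ofReal_pow, Real.sq_sqrt (by norm_num : (0 : ℝ) ≤ 3)]
    norm_num
  simp [h3]

/-- `(Real.sqrt 3 : ℂ) ≠ 0`. -/
theorem sqrt_three_ne_zero : (Real.sqrt 3 : ℂ) ≠ 0 := by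
  rw [Ne, Complex.ofReal_eq_zero]
  exact Real.sqrt_ne_zero'.mpr (by norm_num)

/-- A rational number is algebraic (in the `Rat.cast` normal form); private print-twin of
`Literature.NumberTheory.Transcendental.RoyWaldschmidt1997.isAlgebraic_ratCast` (dedup). -/
private theorem isAlgebraic_ratCast (q : ℚ) : IsAlgebraic ℚ (q : ℂ) := by
  have h := isAlgebraic_algebraMap (R := ℚ) (A := ℂ) q
  rwa [eq_ratCast] at h

/-- **`π√3` is transcendental** (else `π = π√3 · (√3)⁻¹` would be algebraic). -/
theorem transcendental_pi_mul_sqrt_three : Transcendental ℚ ((Real.pi : ℂ) * (Real.sqrt 3 : ℂ)) := by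
  intro h
  apply transcendental_pi_coe
  have h' : IsAlgebraic ℚ ((Real.pi : ℂ) * (Real.sqrt 3 : ℂ) * (Real.sqrt 3 : ℂ)⁻¹) :=
    h.mul (IsAlgebraic.inv_iff.mpr isAlgebraic_sqrt_three)
  rwa [mul_inv_cancel_right₀ sqrt_three_ne_zero] at h'

/-- `t · π√3 = r` with `t, r ∈ ℚ` forces `t = r = 0`. -/
theorem rat_mul_pi_sqrt_three_eq_rat {t r : ℚ} (h : (t : ℂ) * ((Real.pi : ℂ) * (Real.sqrt 3 : ℂ)) = (r : ℂ)) :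
    t = 0 ∧ r = 0 := by
  by_cases ht : t = 0
  · subst ht
    refine ⟨rfl, ?_⟩
    have : ((r : ℚ) : ℂ) = 0 := by rw [← h]; simp
    exact_mod_cast this
  · exfalso
    apply transcendental_pi_mul_sqrt_three
    have htc : (t : ℂ) ≠ 0 := by exact_mod_cast ht
    have hq : (Real.pi : ℂ) * (Real.sqrt 3 : ℂ) = ((r / t : ℚ) : ℂ) := by
      push_cast
      field_simp
      linear_combination h
    rw [hq]
    exact isAlgebraic_ratCast _

/-- **THE `√3`-NESTERENKO TRIPLE `z₃ = (1, π√3, iπ√3)`.** -/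
def sqrtThreeTriple : Fin 3 → ℂ :=
  ![1, (Real.pi : ℂ) * (Real.sqrt 3 : ℂ), (Real.pi : ℂ) * (Real.sqrt 3 : ℂ) * I]

/-- `z₃` is ℚ-free (`π√3 ∉ ℚ`, from the transcendence of `π`). -/
theorem sqrtThreeTriple_linearIndependent : LinearIndependent ℚ sqrtThreeTriple := by
  rw [Fintype.linearIndependent_iff]
  intro g hg
  simp only [Fin.sum_univ_three, sqrtThreeTriple, Matrix.cons_val_zero, Matrix.cons_val_one,
    Matrix.cons_val_two, Matrix.tail_cons, Matrix.head_cons, Rat.smul_def] at hg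
  -- split off the `I`-component: `hg : g0 + g1·(π√3) + g2·(π√3)·I = 0`
  have hps : ((Real.pi : ℂ) * (Real.sqrt 3 : ℂ)) ≠ 0 := mul_ne_zero (by exact_mod_cast Real.pi_ne_zero) sqrt_three_ne_zero
  have hre := congrArg Complex.re hg
  have him := congrArg Complex.im hg
  simp only [Complex.add_re, Complex.add_im, Complex.mul_re, Complex.mul_im, Complex.ofReal_re,
    Complex.ofReal_im, Complex.I_re, Complex.I_im, Complex.ratCast_re, Complex.ratCast_im,
    Complex.zero_re, Complex.zero_im, mul_zero, zero_mul, sub_zero, add_zero, zero_add,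
    mul_one, sub_self] at hre him
  -- hre : g0 + g1 (π √3) = 0 ; him : g2 (π √3) = 0  (real equations)
  have hπs : Real.pi * Real.sqrt 3 ≠ 0 :=
    mul_ne_zero Real.pi_ne_zero (Real.sqrt_ne_zero'.mpr (by norm_num))
  have h2 : (g 2 : ℝ) = 0 := by
    have h : (g 2 : ℝ) * (Real.pi * Real.sqrt 3) = 0 := by linear_combination him
    exact (mul_eq_zero.mp h).resolve_right hπs
  have h1 : (g 1 : ℂ) * ((Real.pi : ℂ) * (Real.sqrt 3 : ℂ)) = ((-g 0 : ℚ) : ℂ) := by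
    have h : (g 1 : ℝ) * (Real.pi * Real.sqrt 3) = -(g 0 : ℝ) := by linear_combination hre
    have h' := congrArg (fun x : ℝ => (x : ℂ)) h
    push_cast at h' ⊢
    exact h'
  obtain ⟨hg1, hg0⟩ := rat_mul_pi_sqrt_three_eq_rat h1
  intro i
  fin_cases i
  · simpa using hg0
  · exact hg1
  · exact_mod_cast h2

/-- `z₃` has NO irrational ALGEBRAIC multiplier (so it is PLAIN): an algebraic `β` with `β · 1 ∈ span_ℚ z₃` is
`a₀ + (a₁ + a₂ i)·π√3`, and `π√3` is transcendental. -/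
theorem sqrtThreeTriple_multiplier_rational (β : ℂ) (hβa : IsAlgebraic ℚ β)
    (hβ : ∀ i, β * sqrtThreeTriple i ∈ Submodule.span ℚ (Set.range sqrtThreeTriple)) :
    β ∈ Set.range (algebraMap ℚ ℂ) := by
  obtain ⟨a, ha⟩ := (Submodule.mem_span_range_iff_exists_fun ℚ).mp (hβ 0)
  simp only [Fin.sum_univ_three, sqrtThreeTriple, Matrix.cons_val_zero, Matrix.cons_val_one,
    Matrix.cons_val_two, Matrix.tail_cons, Matrix.head_cons, Rat.smul_def, mul_one] at ha
  set w : ℂ := (a 1 : ℂ) + (a 2 : ℂ) * I with hw_def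
  have hβw : β = (a 0 : ℂ) + w * ((Real.pi : ℂ) * (Real.sqrt 3 : ℂ)) := by
    rw [hw_def]; linear_combination -ha
  by_cases hw : w = 0
  · refine ⟨a 0, ?_⟩
    rw [eq_ratCast, hβw, hw, zero_mul, add_zero]
  · exfalso
    apply transcendental_pi_mul_sqrt_three
    have hwalg : IsAlgebraic ℚ w :=
      (isAlgebraic_ratCast (a 1)).add ((isAlgebraic_ratCast (a 2)).mul isAlgebraic_I)
    have halg : IsAlgebraic ℚ ((β - (a 0 : ℂ)) * w⁻¹) :=
      (hβa.sub (isAlgebraic_ratCast (a 0))).mul (IsAlgebraic.inv_iff.mpr hwalg)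
    have heq : (β - (a 0 : ℂ)) * w⁻¹ = (Real.pi : ℂ) * (Real.sqrt 3 : ℂ) := by
      rw [hβw, add_sub_cancel_left, mul_comm w, mul_inv_cancel_right₀ hw]
    rwa [heq] at halg

/-- `z₃` is a member of 31410's hypothesis class: ℚ-free, plain, sub-minimal. -/
theorem sqrtThreeTriple_mem_plainClass :
    LinearIndependent ℚ sqrtThreeTriple ∧
      (∀ β : ℂ, IsAlgebraic ℚ β → (∀ i, β * sqrtThreeTriple i ∈ Submodule.span ℚ (Set.range sqrtThreeTriple)) →
        β ∈ Set.range (algebraMap ℚ ℂ)) ∧ SubMinimalDefect 3 sqrtThreeTriple :=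
  ⟨sqrtThreeTriple_linearIndependent, sqrtThreeTriple_multiplier_rational, subMinimal_three _⟩

/-- `π√3 ∈ span_ℚ z₃`. -/
theorem pi_mul_sqrt_three_mem_span :
    (Real.pi : ℂ) * (Real.sqrt 3 : ℂ) ∈ Submodule.span ℚ (Set.range sqrtThreeTriple) :=
  Submodule.subset_span ⟨1, by simp [sqrtThreeTriple]⟩

/-- `π` is algebraic over `F_{z₃}` (`π = π√3 · (√3)⁻¹`, `π√3 ∈ F`, `√3 ∈ ℚ̄`). -/
theorem pi_isAlgebraic_sqrtThreeTriple :
    IsAlgebraic ↥(adjoin ℚ (Set.range sqrtThreeTriple ∪ Set.range (cexp ∘ sqrtThreeTriple))) (Real.pi : ℂ) := by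
  have hps : IsAlgebraic ↥(adjoin ℚ (Set.range sqrtThreeTriple ∪ Set.range (cexp ∘ sqrtThreeTriple)))
      ((Real.pi : ℂ) * (Real.sqrt 3 : ℂ)) :=
    isAlgebraic_of_mem_adjoin (mem_adjoin_of_mem_span pi_mul_sqrt_three_mem_span)
  have hs : IsAlgebraic ↥(adjoin ℚ (Set.range sqrtThreeTriple ∪ Set.range (cexp ∘ sqrtThreeTriple)))
      (Real.sqrt 3 : ℂ)⁻¹ :=
    IsAlgebraic.inv_iff.mpr (isAlgebraic_sqrt_three.tower_top _)
  have h := hps.mul hs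
  rwa [mul_inv_cancel_right₀ sqrt_three_ne_zero] at h

/-- `z₃` is Nesterenko-rich through clause (N′). -/
theorem sqrtThreeTriple_periodRich : PeriodRich sqrtThreeTriple :=
  ⟨pi_isAlgebraic_sqrtThreeTriple, Or.inr (exp_isAlgebraic_of_mem_span pi_mul_sqrt_three_mem_span)⟩

/-- **`trdeg ℚ(π√3, e, e^{π√3}, e^{iπ√3}) ≥ 2`, mod `nesterenko'` only** (Nesterenko's `π ⊥ e^{π√3}`). -/
theorem two_le_trdeg_sqrtThreeTriple (hN' : nesterenko') :
    (2 : Cardinal) ≤ Algebra.trdeg ℚ ↥(adjoin ℚ (Set.range sqrtThreeTriple ∪ Set.range (cexp ∘ sqrtThreeTriple))) := by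
  refine two_le_trdeg_of_algebraicIndependent_of_isAlgebraic _ (algebraicIndependent_pi_exp_pi_sqrt_three hN') ?_
  intro i; fin_cases i
  · exact pi_isAlgebraic_sqrtThreeTriple
  · exact exp_isAlgebraic_of_mem_span pi_mul_sqrt_three_mem_span

/-- **The conclusion of stmt-31410 at its member `z₃`, PROVED mod `nesterenko'`.** -/
theorem defectOne_at_sqrtThreeTriple (hN' : nesterenko') :
    ((3 : ℕ) : Cardinal) ≤
      Algebra.trdeg ℚ ↥(adjoin ℚ (Set.range sqrtThreeTriple ∪ Set.range (cexp ∘ sqrtThreeTriple))) + 1 := by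
  have h3 : (2 : Cardinal) + 1 ≤
      Algebra.trdeg ℚ ↥(adjoin ℚ (Set.range sqrtThreeTriple ∪ Set.range (cexp ∘ sqrtThreeTriple))) + 1 :=
    add_le_add (two_le_trdeg_sqrtThreeTriple hN') le_rfl
  have h21 : (2 : Cardinal) + 1 = 3 := by norm_num
  rw [h21] at h3
  exact_mod_cast h3

/-- `EngineRich sqrtThreeTriple`. -/
theorem engineRich_sqrtThreeTriple : EngineRich sqrtThreeTriple := Or.inr (Or.inr sqrtThreeTriple_periodRich)

end Summit.Schanuel.Schanuel.Theorems.RootDecomp1EEngineType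

end
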